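import Summits.QuantumFields.YangMills.Theorems.BalabanUVNodesK3V5Defs
import Literature.MathematicalPhysics.QuantumFieldTheory.Balaban1983to89.Node00.Record13SepCoPHV

/-!
# K3⁸ v6 — THE THREE SLOT-KEYED FACES `…V`, THEIR (B)-FREE SHAPES `…BFree`, THE TRANSFER LEMMAS, THE `Iff.rfl` BRIDGE TO THE rev-28 ROUTE DECL AND THE BY-NAME COMPOSITIONS —
# the tree MIRROR of skeleton v6's §1V ∕ §3V texts over this seat's v5 mirror `…K3V5Defs` (p606160), so that K3⁸ stub proofs and their (B)-free supplier roads can be filed BY NAME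

Cell `pub-ymgap` (HUMAN RULING D-0062 Track A; director-ym №210 (δⱽ) NULL-SET SURGERY, chair ■ R463, dag-lead KEY MAP v2), WIDTH SEAT `pub-ymgap-dag-n27-w1` (gen 4) on NODE n27 (B5 composite).
`--supports stmt-QuantumFields-27366 --as helper` (count-neutral).  Precedent and pattern: this seat's gen-2 `Thm/BalabanUVNodesK3V5Defs.lean` (K3⁷ v5), dag-n24-w1's `K1V6Defs`, k0-s2-w1's
`K0V19Defs`; dag-n27-c g15 l.35594 «k3v6 §1V's `…V`∕`…BFree` PREDICATES are the plan's ∕ n27-w1's mirror to mint».  [I] = [Balaban1987RG1]; [III] = [Balaban1988Convergent]; [IV] = [Balaban1989LargeFieldII].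

WHY.  Route rev 28∕29 (2026-08-28 09:54–09:58Z) re-typed K3 through DEF-1's VERSION SLOT: K3⁸ `Theses.BalabanUVNodes.SpineGivenEndpointR13SepCoPHV` (stmt-QuantumFields-27366) = K3⁷ (20544, now
aside) asked at every admissible ∕ unity Stage-13 tuple with separated provisos `h` AND EVERY `v : Node00.Revision₁₃ F 2 θ h`, (B) and END read at the slot datum `Node00.datumOfRecord₁₃SepCoPHV F 2 θ h v`.
Plan g85's skeleton v6 (`HOME/pub-ymgap-plan/D85-REV28/k3v6/K3Skeleton13SepCoPHv6.lean`) keeps v5's §0–§2 ∕ §1c ∕ §4 BYTE-IDENTICAL (those texts are ALREADY in the tree: `K3V5Defs` §1, imported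
and REUSED BY NAME here — nothing re-declared) and adds §1V = dag-n17-w2 g6's three slot-keyed faces `KeyedRatesHolderD4V` ∕ `KeyedCoreEdgeHolderD4V` ∕ `KeyedExtractionV`, their (B)-FREE,
END-FREE shapes `…BFree` (what every ∀-`g₀` ∕ (B)-blind supplier road actually proves) and the transfer lemmas `…V_of_bFree` ∕ `…_of_bFree` ∕ `keyedRatesHolderD4Sep_of_V`; §3V = v5's two stub
texts with the three prefixed faces swapped for the `…V` editions.  THIS FILE puts §1V into the tree VERBATIM (modulo the `K3V5Defs` names) and, as §2, the `Iff.rfl` bridge to the route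
decl plus the by-name composition of the two v6 stub TEXTS onto K3⁸ (= the kit's `SpineGivenEndpointR13SepCoPHV_of`, ONE application per slot tuple of dag-n19-w3's GENERIC FSC composer
`forall_keyed_hybridNE7Under_of_fscFacesP`, p595910) and the same composition from the (B)-FREE stub texts (the door every (B)-free road — dag-n27-c g15's body currency, this seat's
minted storeys — walks through: transfer lemmas, then the composer).

CONTENTS.  §1V `KeyedRatesHolderD4V` · `KeyedRatesHolderD4BFree` · `keyedRatesHolderD4V_of_bFree` · `keyedRatesHolderD4_of_bFree` · `keyedRatesHolderD4Sep_of_V` · `KeyedCoreEdgeHolderD4V` ·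
`KeyedCoreEdgeHolderD4BFree` · `keyedCoreEdgeHolderD4V_of_bFree` · `keyedCoreEdgeHolderD4_of_bFree` · `KeyedExtractionV` · `KeyedExtractionBFree` · `keyedExtractionV_of_bFree` ·
`keyedExtraction_of_bFree` (v6 §1V texts VERBATIM).  §2 `spineGivenEndpointR13SepCoPHV_iff` (`Iff.rfl`) · `spineGivenEndpointR13SepCoPHV_of_stubTextsV` (the two v6 texts ⟹ K3⁸ BY NAME) ·
`spineGivenEndpointR13SepCoPHV_of_stubTextsBFree` (the two texts in their (B)-FREE shapes ⟹ K3⁸, via the transfer lemmas) · `spineGivenEndpointR13SepCoPH_of_stubTextsBFree` (… ⟹ the aside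
K3⁷ display too, via `…_of_bFree` + `K3V5Defs.spineGivenEndpointR13SepCoPH_of_stubTexts`).

HONEST FRAMING.  Definitions (texts mirrored from the plan's kit ∕ dag-n17-w2's probe, nothing new asserted), one `Iff.rfl`, by-name compositions (pure logic over dag-n19-w3's composer);
no estimate; no stub of v6 (or v5) is proved or claimed here; the three faces and their (B)-free shapes are PREDICATES whose inhabitation is exactly the open content of K3⁸ (NE7-cluster ∕
K5 ∕ the N19′ edge ∕ the rates — none of NE1′–NE9 in print for d = 4; K0⁷ `Record13SepCoPHInhabited` OPEN, so every ∀-tuple statement is inhabited-for-no-family today); NOTHING of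
Bałaban asserted or instantiated; N14–N22 ∕ N27 NOT discharged; K3⁸ stmt-QuantumFields-27366 OPEN · unclaimed (skeleton of record = the plan's v6 once registered by op 5 — this file
neither replaces nor registers it; if the registered texts differ from the kit's, this file is superseded, not edited); K3⁷ 20544 aside.  Counts unmoved (typed 28∕28 · discharged 5∕27,
A 5∕28).  One finite 𝕋⁴ programme at fixed `ε`, Bałaban AS PRINTED — R4 closes the CONDITIONAL finite-𝕋⁴ rung `BalabanLadder.UV` only: NOT continuum ∕ ℝ⁴ ∕ OS ∕ mass gap ∕ Clay;
the Yang–Mills mass gap is NOT proved by any of this.  No `sorry`, `instance`, `notation`; standard axioms.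
-/

noncomputable section

open scoped Matrix.Norms.L2Operator

namespace Summit.QuantumFields.YangMills.Theorems.K3V6Defs

open Literature.MathematicalPhysics.QuantumFieldTheory.Balaban1983to89
open Literature.MathematicalPhysics.QuantumFieldTheory.Balaban1983to89.T4Continuum
open T4ContinuumYM4Torus (ForSmallCouplings)
open T4ApexHybrid (HybridNE7Under)
open Summit.QuantumFields.BalabanUV.T4Continuum.Spine
open YMDAG.UVSplit
open Node00 (Stage13HParams datumOfRecord₁₃CoPH datumOfRecord₁₃SepCoPH datumOfRecord₁₃SepCoPHV Revision₁₃)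
open Summit.QuantumFields.YangMills.Theorems.K3V5Defs

/-! ## §1V (v6, plan g85, rev 28 recipe (δⱽ)) The three (B)-prefixed faces re-keyed at the version slot + their (B)-free shapes and transfer lemmas — texts VERBATIM from the kit
(= dag-n17-w2 g6's probe `Cruxes/SpineGivenEndpointR13SepCoPH/N17W2K3R8VersionSlotProbe.lean`): key = the item's own separated provisos `h` + DEF-1's slot `v : Node00.Revision₁₃ F 2 θ h`;
prefix ∕ holder ∕ partition functions read at the re-chosen datum `Node00.datumOfRecord₁₃SepCoPHV F 2 θ h v`; readings `cr`∕`rr` at `h.toCore` -/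

/-- «K4 at the slot»: v5's `KeyedRatesHolderD4 β rr` under one extra binder `v`, with (B), END, `ForSmallCouplings`, `PHolderD4` read at `datumOfRecord₁₃SepCoPHV F 2 θ h v` (the reading `rr`
stays keyed on the CORE provisos, `h.toCore`).  v6 stub 1's last conjunct.  A PREDICATE — nothing asserted.
[cite: Balaban1987RG1, Thm 2 p.259; Balaban1989LargeFieldII, (0.1) p.356 (statement shape only; bookkeeping)] -/
def KeyedRatesHolderD4V (β : ℝ) (rr : RateReadingFn) : Prop :=
  ∀ (F : T4Family) (θ : Stage13HParams F 2) (h : θ.Provisos₁₃SepCoPH F 2) (v : Revision₁₃ F 2 θ h), (θ.ZhUnity F 2 ∧ θ.SlotsNondegenerate₁₃ F 2) → θ.Admissible F 2 →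
    B16.EndStatementBPrinted (datumOfRecord₁₃SepCoPHV F 2 θ h v).C → DagBinding.EndpointExistence (datumOfRecord₁₃SepCoPHV F 2 θ h v).C.toB12 →
      ForSmallCouplings (datumOfRecord₁₃SepCoPHV F 2 θ h v) fun g₀ => ∀ os : List (ULoop F), PHolderD4 β (datumOfRecord₁₃SepCoPHV F 2 θ h v) (rr F θ h.toCore g₀ os)

/-- The (B)-FREE, END-FREE shape of the K4 face — what every ∀-`g₀` supplier road (`ForSmallCouplings.of_forall`) and every road not reading (B) actually proves.  A PREDICATE.
[cite: Balaban1987RG1, Thm 2 p.259 (statement shape only; bookkeeping)] -/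
def KeyedRatesHolderD4BFree (β : ℝ) (rr : RateReadingFn) : Prop :=
  ∀ (F : T4Family) (θ : Stage13HParams F 2) (hP : θ.Provisos₁₃CoPH F 2), (θ.ZhUnity F 2 ∧ θ.SlotsNondegenerate₁₃ F 2) → θ.Admissible F 2 →
    ForSmallCouplings (datumOfRecord₁₃CoPH F 2 θ hP) fun g₀ => ∀ os : List (ULoop F), PHolderD4 β (datumOfRecord₁₃CoPH F 2 θ hP) (rr F θ hP g₀ os)

/-- **A (B)-free road of v5's K4 face TRANSFERS TO EVERY VERSION `v` VERBATIM** (DEF-1's `rfl` faces: `Tuned` ∕ `scheme` ∕ `βfun` ∕ `flow` of the slot datum are the record's). [bookkeeping] -/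
theorem keyedRatesHolderD4V_of_bFree {β : ℝ} {rr : RateReadingFn} (hfree : KeyedRatesHolderD4BFree β rr) : KeyedRatesHolderD4V β rr :=
  fun F θ h _v hG hθ _ _ => hfree F θ h.toCore hG hθ

/-- … and of course gives v5's own (B)-keyed face `K3V5Defs.KeyedRatesHolderD4`. [bookkeeping] -/
theorem keyedRatesHolderD4_of_bFree {β : ℝ} {rr : RateReadingFn} (hfree : KeyedRatesHolderD4BFree β rr) : KeyedRatesHolderD4 β rr :=
  fun F θ hP hG hθ _ _ => hfree F θ hP hG hθ

/-- DOOR (`v := Revision₁₃.refl`): the slot-keyed K4 face at every `v` gives v5's face on the SEPARATED-provisos tuples (the item's own key; `datumOfRecord₁₃SepCoPHV … (.refl) =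
datumOfRecord₁₃SepCoPH …` by `rfl`). [bookkeeping] -/
theorem keyedRatesHolderD4Sep_of_V {β : ℝ} {rr : RateReadingFn} (hV : KeyedRatesHolderD4V β rr) (F : T4Family) (θ : Stage13HParams F 2) (h : θ.Provisos₁₃SepCoPH F 2)
    (hG : θ.ZhUnity F 2 ∧ θ.SlotsNondegenerate₁₃ F 2) (hθ : θ.Admissible F 2) (hB : B16.EndStatementBPrinted (datumOfRecord₁₃SepCoPH F 2 θ h).C)
    (hE : DagBinding.EndpointExistence (datumOfRecord₁₃SepCoPH F 2 θ h).C.toB12) :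
    ForSmallCouplings (datumOfRecord₁₃CoPH F 2 θ h.toCore) fun g₀ => ∀ os : List (ULoop F), PHolderD4 β (datumOfRecord₁₃CoPH F 2 θ h.toCore) (rr F θ h.toCore g₀ os) :=
  hV F θ h (Revision₁₃.refl F 2 θ h) hG hθ hB hE

/-- «N19′ at the slot»: v5's `KeyedCoreEdgeHolderD4 β cr rr` under the binder `v`, prefix and `PHolderD4` read at the revised datum (the spine reading `cr` and the rate reading `rr` stay keyed
on the core provisos).  v6 stub 2's last conjunct.  A PREDICATE — nothing asserted.
[cite: Balaban1987RG1, Thm 2 p.259; Balaban1985UVStability3d, §3 (statement shape only; bookkeeping)] -/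
def KeyedCoreEdgeHolderD4V (β : ℝ) (cr : SpineReading) (rr : RateReadingFn) : Prop :=
  ∀ (F : T4Family) (θ : Stage13HParams F 2) (h : θ.Provisos₁₃SepCoPH F 2) (v : Revision₁₃ F 2 θ h), (θ.ZhUnity F 2 ∧ θ.SlotsNondegenerate₁₃ F 2) → θ.Admissible F 2 →
    B16.EndStatementBPrinted (datumOfRecord₁₃SepCoPHV F 2 θ h v).C → DagBinding.EndpointExistence (datumOfRecord₁₃SepCoPHV F 2 θ h v).C.toB12 →
      ForSmallCouplings (datumOfRecord₁₃SepCoPHV F 2 θ h v) fun g₀ => ∀ os : List (ULoop F),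
        PHolderD4 β (datumOfRecord₁₃SepCoPHV F 2 θ h v) (rr F θ h.toCore g₀ os) → letI := (cr F θ h.toCore g₀ os).dec
          ∃ δ : ℕ → ℝ, NE7.Core (cr F θ h.toCore g₀ os).l₀ (cr F θ h.toCore g₀ os).vol (cr F θ h.toCore g₀ os).T (cr F θ h.toCore g₀ os).Bad
            (fun K t τ => (cr F θ h.toCore g₀ os).A K t τ - (cr F θ h.toCore g₀ os).shA K t τ)
            (fun K t τ => (cr F θ h.toCore g₀ os).B K t τ - (cr F θ h.toCore g₀ os).shB K t τ) δ ∧ Summable δ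

/-- The (B)-FREE, END-FREE shape of the N19′ face (every road not reading (B) ∕ END proves this).  A PREDICATE.
[cite: Balaban1987RG1, Thm 2 p.259 (statement shape only; bookkeeping)] -/
def KeyedCoreEdgeHolderD4BFree (β : ℝ) (cr : SpineReading) (rr : RateReadingFn) : Prop :=
  ∀ (F : T4Family) (θ : Stage13HParams F 2) (hP : θ.Provisos₁₃CoPH F 2), (θ.ZhUnity F 2 ∧ θ.SlotsNondegenerate₁₃ F 2) → θ.Admissible F 2 →
    ForSmallCouplings (datumOfRecord₁₃CoPH F 2 θ hP) fun g₀ => ∀ os : List (ULoop F),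
      PHolderD4 β (datumOfRecord₁₃CoPH F 2 θ hP) (rr F θ hP g₀ os) → letI := (cr F θ hP g₀ os).dec
        ∃ δ : ℕ → ℝ, NE7.Core (cr F θ hP g₀ os).l₀ (cr F θ hP g₀ os).vol (cr F θ hP g₀ os).T (cr F θ hP g₀ os).Bad
          (fun K t τ => (cr F θ hP g₀ os).A K t τ - (cr F θ hP g₀ os).shA K t τ) (fun K t τ => (cr F θ hP g₀ os).B K t τ - (cr F θ hP g₀ os).shB K t τ) δ ∧ Summable δ

/-- **A (B)-free road of v5's N19′ face TRANSFERS TO EVERY VERSION `v` VERBATIM.** [bookkeeping] -/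
theorem keyedCoreEdgeHolderD4V_of_bFree {β : ℝ} {cr : SpineReading} {rr : RateReadingFn} (hfree : KeyedCoreEdgeHolderD4BFree β cr rr) :
    KeyedCoreEdgeHolderD4V β cr rr :=
  fun F θ h _v hG hθ _ _ => hfree F θ h.toCore hG hθ

/-- … and gives v5's own face `K3V5Defs.KeyedCoreEdgeHolderD4`. [bookkeeping] -/
theorem keyedCoreEdgeHolderD4_of_bFree {β : ℝ} {cr : SpineReading} {rr : RateReadingFn} (hfree : KeyedCoreEdgeHolderD4BFree β cr rr) :
    KeyedCoreEdgeHolderD4 β cr rr :=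
  fun F θ hP hG hθ _ _ => hfree F θ hP hG hθ

/-- «N27x at the slot»: v5's `KeyedExtraction cr` under the binder `v`, prefix and partition functions read at the revised datum.  v6 stub 2's extraction conjunct.  A PREDICATE — nothing
asserted. [cite: Balaban1988Convergent, (3.23) p.270 (the representation; statement shape only; bookkeeping)] -/
def KeyedExtractionV (cr : SpineReading) : Prop :=
  ∀ (F : T4Family) (θ : Stage13HParams F 2) (h : θ.Provisos₁₃SepCoPH F 2) (v : Revision₁₃ F 2 θ h), (θ.ZhUnity F 2 ∧ θ.SlotsNondegenerate₁₃ F 2) → θ.Admissible F 2 →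
    B16.EndStatementBPrinted (datumOfRecord₁₃SepCoPHV F 2 θ h v).C → DagBinding.EndpointExistence (datumOfRecord₁₃SepCoPHV F 2 θ h v).C.toB12 →
      ForSmallCouplings (datumOfRecord₁₃SepCoPHV F 2 θ h v) fun g₀ => ∀ os : List (ULoop F),
        0 < (cr F θ h.toCore g₀ os).l₀ ∧ 0 < (cr F θ h.toCore g₀ os).vol ∧
        (∀ (K : ℕ) (t : ℝ), |t| ≤ (cr F θ h.toCore g₀ os).l₀ →
          T4GenFunBounds.schemeZ ((datumOfRecord₁₃SepCoPHV F 2 θ h v).scheme g₀) os ((cr F θ h.toCore g₀ os).K₀ + K) t =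
            ∑ τ ∈ (cr F θ h.toCore g₀ os).T K, (cr F θ h.toCore g₀ os).A K t τ) ∧
        (∀ (K : ℕ) (t : ℝ), |t| ≤ (cr F θ h.toCore g₀ os).l₀ →
          T4GenFunBounds.schemeZ ((datumOfRecord₁₃SepCoPHV F 2 θ h v).scheme g₀) os ((cr F θ h.toCore g₀ os).K₀ + K + 1) t =
            ∑ τ ∈ (cr F θ h.toCore g₀ os).T K, (cr F θ h.toCore g₀ os).B K t τ)

/-- The (B)-FREE, END-FREE shape of the N27x face.  A PREDICATE. [cite: Balaban1988Convergent, (3.23) p.270 (the representation; statement shape only; bookkeeping)] -/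
def KeyedExtractionBFree (cr : SpineReading) : Prop :=
  ∀ (F : T4Family) (θ : Stage13HParams F 2) (hP : θ.Provisos₁₃CoPH F 2), (θ.ZhUnity F 2 ∧ θ.SlotsNondegenerate₁₃ F 2) → θ.Admissible F 2 →
    ForSmallCouplings (datumOfRecord₁₃CoPH F 2 θ hP) fun g₀ => ∀ os : List (ULoop F),
      0 < (cr F θ hP g₀ os).l₀ ∧ 0 < (cr F θ hP g₀ os).vol ∧
      (∀ (K : ℕ) (t : ℝ), |t| ≤ (cr F θ hP g₀ os).l₀ →
        T4GenFunBounds.schemeZ ((datumOfRecord₁₃CoPH F 2 θ hP).scheme g₀) os ((cr F θ hP g₀ os).K₀ + K) t = ∑ τ ∈ (cr F θ hP g₀ os).T K, (cr F θ hP g₀ os).A K t τ) ∧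
      (∀ (K : ℕ) (t : ℝ), |t| ≤ (cr F θ hP g₀ os).l₀ →
        T4GenFunBounds.schemeZ ((datumOfRecord₁₃CoPH F 2 θ hP).scheme g₀) os ((cr F θ hP g₀ os).K₀ + K + 1) t = ∑ τ ∈ (cr F θ hP g₀ os).T K, (cr F θ hP g₀ os).B K t τ)

/-- **A (B)-free road of v5's N27x face TRANSFERS TO EVERY VERSION `v` VERBATIM** (the partition functions are the record's: DEF-1's `scheme_datumOfRecord₁₃SepCoPHV`, `rfl`). [bookkeeping] -/
theorem keyedExtractionV_of_bFree {cr : SpineReading} (hfree : KeyedExtractionBFree cr) : KeyedExtractionV cr :=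
  fun F θ h _v hG hθ _ _ => hfree F θ h.toCore hG hθ

/-- … and gives v5's own face `K3V5Defs.KeyedExtraction`. [bookkeeping] -/
theorem keyedExtraction_of_bFree {cr : SpineReading} (hfree : KeyedExtractionBFree cr) : KeyedExtraction cr :=
  fun F θ hP hG hθ _ _ => hfree F θ hP hG hθ

/-! ## §2 The `Iff.rfl` bridge to the rev-28 route decl and the by-name compositions (= the kit's `SpineGivenEndpointR13SepCoPHV_of`; plus the (B)-free door) -/

/-- **K3⁸ ⟺ ITS BODY** (`Iff.rfl`): `SpineGivenEndpointR13SepCoPHV` IS «for every guarded admissible Stage-13 tuple with separated provisos `h` and every version slot `v`, (B) → END →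
`HybridNE7Under (datumOfRecord₁₃SepCoPHV F 2 θ h v) END`», both antecedents read at the slot datum. [bookkeeping] -/
theorem spineGivenEndpointR13SepCoPHV_iff :
    Summit.QuantumFields.YangMills.Theses.BalabanUVNodes.SpineGivenEndpointR13SepCoPHV ↔
      ∀ (F : T4Family) (θ : Stage13HParams F 2) (h : θ.Provisos₁₃SepCoPH F 2) (v : Revision₁₃ F 2 θ h), (θ.ZhUnity F 2 ∧ θ.SlotsNondegenerate₁₃ F 2) → θ.Admissible F 2 →
        B16.EndStatementBPrinted (datumOfRecord₁₃SepCoPHV F 2 θ h v).C → DagBinding.EndpointExistence (datumOfRecord₁₃SepCoPHV F 2 θ h v).C.toB12 →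
          HybridNE7Under (datumOfRecord₁₃SepCoPHV F 2 θ h v) (DagBinding.EndpointExistence (datumOfRecord₁₃SepCoPHV F 2 θ h v).C.toB12) :=
  Iff.rfl

/-- **K3⁸ FROM ITS FIVE SLOT-KEYED ∕ SLOT-FREE FACES** at one spine reading `cr` and one rate reading `rr` (any `β`): N20 `KeyedRelWeight cr` · N21 `KeyedShellWeight cr` (slot-free, v5's) ·
K4 `KeyedRatesHolderD4V β rr` · N19′ `KeyedCoreEdgeHolderD4V β cr rr` · N27x `KeyedExtractionV cr` ⟹ `SpineGivenEndpointR13SepCoPHV` — ONE application per slot tuple of dag-n19-w3's GENERIC FSC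
composer `forall_keyed_hybridNE7Under_of_fscFacesP` (p595910) at the key `Σ' θ (h : Provisos₁₃SepCoPH), Revision₁₃ F 2 θ h`, `Hp := ⊤`, `Adm := (ZhUnity ∧ SlotsNondegenerate₁₃) ∧ Admissible`,
`datumOf := datumOfRecord₁₃SepCoPHV`, readings at `h.toCore`, `P := PHolderD4 β` (the kit's composition term VERBATIM; leaf D's `spineGivenEndpointR13SepCoPH_of_keyedFacesP` is the v5 analogue).
Every face a HYPOTHESIS; nothing of Bałaban's proved. [bookkeeping] -/
theorem spineGivenEndpointR13SepCoPHV_of_facesV (β : ℝ) (cr : SpineReading) (rr : RateReadingFn)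
    (h20 : KeyedRelWeight cr) (h21 : KeyedShellWeight cr) (hr : KeyedRatesHolderD4V β rr) (h19 : KeyedCoreEdgeHolderD4V β cr rr) (hx : KeyedExtractionV cr) :
    Summit.QuantumFields.YangMills.Theses.BalabanUVNodes.SpineGivenEndpointR13SepCoPHV := by
  intro F θ h v hG hθ _ _
  exact Summit.QuantumFields.YangMills.BalabanUVNodes.N19CoreEdgeFSCComposer.forall_keyed_hybridNE7Under_of_fscFacesP (N := 2)
    (Θ := fun F => Σ' (θ : Stage13HParams F 2) (h : θ.Provisos₁₃SepCoPH F 2), Revision₁₃ F 2 θ h)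
    (fun {F} _ => True) (fun {F} k => (k.1.ZhUnity F 2 ∧ k.1.SlotsNondegenerate₁₃ F 2) ∧ k.1.Admissible F 2)
    (fun {F} k _ => datumOfRecord₁₃SepCoPHV F 2 k.1 k.2.1 k.2.2) (fun {F} k _ g₀ os => cr F k.1 k.2.1.toCore g₀ os)
    (fun {F} k _ g₀ os => rr F k.1 k.2.1.toCore g₀ os) (PHolderD4 β)
    (fun F k _ hA g₀ os => h20 F k.1 k.2.1.toCore hA.1 hA.2 g₀ os) (fun F k _ hA g₀ os => h21 F k.1 k.2.1.toCore hA.1 hA.2 g₀ os)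
    (fun F k _ hA => hr F k.1 k.2.1 k.2.2 hA.1 hA.2) (fun F k _ hA => h19 F k.1 k.2.1 k.2.2 hA.1 hA.2) (fun F k _ hA => hx F k.1 k.2.1 k.2.2 hA.1 hA.2)
    F ⟨θ, h, v⟩ trivial ⟨hG, hθ⟩

/-- **… AND FROM THE FIVE FACES IN THEIR (B)-FREE SHAPES** (transfer lemmas `…V_of_bFree`, then `spineGivenEndpointR13SepCoPHV_of_facesV`): the door every road that never reads (B) ∕ END
walks through — ∀-`g₀` suppliers, dag-n27-c g15's (B)-free spine body, this seat's minted storeys.  Every face a HYPOTHESIS. [bookkeeping] -/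
theorem spineGivenEndpointR13SepCoPHV_of_facesBFree (β : ℝ) (cr : SpineReading) (rr : RateReadingFn)
    (h20 : KeyedRelWeight cr) (h21 : KeyedShellWeight cr) (hr : KeyedRatesHolderD4BFree β rr) (h19 : KeyedCoreEdgeHolderD4BFree β cr rr) (hx : KeyedExtractionBFree cr) :
    Summit.QuantumFields.YangMills.Theses.BalabanUVNodes.SpineGivenEndpointR13SepCoPHV :=
  spineGivenEndpointR13SepCoPHV_of_facesV β cr rr h20 h21 (keyedRatesHolderD4V_of_bFree hr) (keyedCoreEdgeHolderD4V_of_bFree h19) (keyedExtractionV_of_bFree hx)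

/-- **K3⁸ FROM THE TWO v6 STUB TEXTS, BY NAME** (= the kit's composition `SpineGivenEndpointR13SepCoPHV_of`: stub 1 → stub 2 → `spineGivenEndpointR13SepCoPHV_of_facesV`).  Once the plan registers
v6 on stmt-QuantumFields-27366, a `--supports 27366` proof of either text BY NAME is the registered statement; this theorem composes them.  No stub is proved here. [bookkeeping] -/
theorem spineGivenEndpointR13SepCoPHV_of_stubTextsV
    (h₁ : ∃ β : ℝ, 2 / 3 < β ∧ β < 1 ∧
    ∃ (𝔯 : RateReading₁₃CoPH 2) (ksel : RunSel) (ℓ : LetterReading) (ℓ₃ : T4Family → Node00.NE3Letters₁₁) (g B : T4Family → ℝ),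
      GuardedReadingN16 𝔯 ksel ℓ ℓ₃ g B ∧ KeyedRatesHolderD4V β (rrOfRecord 𝔯 ksel))
    (h₂ : ∀ β : ℝ, 2 / 3 < β → β < 1 →
    ∀ (𝔯 : RateReading₁₃CoPH 2) (ksel : RunSel) (ℓ : LetterReading) (ℓ₃ : T4Family → Node00.NE3Letters₁₁) (g B : T4Family → ℝ),
      GuardedReadingN16 𝔯 ksel ℓ ℓ₃ g B → KeyedRatesHolderD4V β (rrOfRecord 𝔯 ksel) →
      ∃ (jc : CutReading) (sh : ShellSplit₁₃CoPH 2 0) (cr : SpineReading), PinnedAtLive jc sh cr ∧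
        KeyedRelWeight cr ∧ KeyedShellWeight cr ∧ KeyedExtractionV cr ∧ KeyedCoreEdgeHolderD4V β cr (rrOfRecord 𝔯 ksel)) :
    Summit.QuantumFields.YangMills.Theses.BalabanUVNodes.SpineGivenEndpointR13SepCoPHV := by
  obtain ⟨β, hβ, hβ', 𝔯, ksel, ℓ, ℓ₃, g, B, hg, hr⟩ := h₁
  obtain ⟨_jc, _sh, cr, -, h20, h21, hx, h19⟩ := h₂ β hβ hβ' 𝔯 ksel ℓ ℓ₃ g B hg hr
  exact spineGivenEndpointR13SepCoPHV_of_facesV β cr (rrOfRecord 𝔯 ksel) h20 h21 hr h19 hx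

/-- **K3⁸ FROM THE TWO STUB TEXTS IN THEIR (B)-FREE SHAPES** — stub 1's text with `KeyedRatesHolderD4BFree` for its last conjunct, stub 2's text from the (B)-free rates to the (B)-free
faces `KeyedExtractionBFree` ∕ `KeyedCoreEdgeHolderD4BFree`: K3⁸ at EVERY version slot (`spineGivenEndpointR13SepCoPHV_of_facesBFree`).  No stub is proved here. [bookkeeping] -/
theorem spineGivenEndpointR13SepCoPHV_of_stubTextsBFree
    (h₁ : ∃ β : ℝ, 2 / 3 < β ∧ β < 1 ∧
    ∃ (𝔯 : RateReading₁₃CoPH 2) (ksel : RunSel) (ℓ : LetterReading) (ℓ₃ : T4Family → Node00.NE3Letters₁₁) (g B : T4Family → ℝ),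
      GuardedReadingN16 𝔯 ksel ℓ ℓ₃ g B ∧ KeyedRatesHolderD4BFree β (rrOfRecord 𝔯 ksel))
    (h₂ : ∀ β : ℝ, 2 / 3 < β → β < 1 →
    ∀ (𝔯 : RateReading₁₃CoPH 2) (ksel : RunSel) (ℓ : LetterReading) (ℓ₃ : T4Family → Node00.NE3Letters₁₁) (g B : T4Family → ℝ),
      GuardedReadingN16 𝔯 ksel ℓ ℓ₃ g B → KeyedRatesHolderD4BFree β (rrOfRecord 𝔯 ksel) →
      ∃ (jc : CutReading) (sh : ShellSplit₁₃CoPH 2 0) (cr : SpineReading), PinnedAtLive jc sh cr ∧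
        KeyedRelWeight cr ∧ KeyedShellWeight cr ∧ KeyedExtractionBFree cr ∧ KeyedCoreEdgeHolderD4BFree β cr (rrOfRecord 𝔯 ksel)) :
    Summit.QuantumFields.YangMills.Theses.BalabanUVNodes.SpineGivenEndpointR13SepCoPHV := by
  obtain ⟨β, hβ, hβ', 𝔯, ksel, ℓ, ℓ₃, g, B, hg, hr⟩ := h₁
  obtain ⟨_jc, _sh, cr, -, h20, h21, hx, h19⟩ := h₂ β hβ hβ' 𝔯 ksel ℓ ℓ₃ g B hg hr
  exact spineGivenEndpointR13SepCoPHV_of_facesBFree β cr (rrOfRecord 𝔯 ksel) h20 h21 hr h19 hx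

/-- … and the same (B)-free texts give the ASIDE K3⁷ display `SpineGivenEndpointR13SepCoPH` (20544) through `…_of_bFree` and gen 2's `K3V5Defs.spineGivenEndpointR13SepCoPH_of_stubTexts`-shape
composition (leaf D's `spineGivenEndpointR13SepCoPH_of_keyedFacesP` road, here by dag-n19-w3's `keyedGuarded₁₃CoPH_of_keyedFacesP_fsc`) — both displays from ONE (B)-free road, as the (δⱽ)
recipe promises. [bookkeeping] -/
theorem spineGivenEndpointR13SepCoPH_of_stubTextsBFree
    (h₁ : ∃ β : ℝ, 2 / 3 < β ∧ β < 1 ∧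
    ∃ (𝔯 : RateReading₁₃CoPH 2) (ksel : RunSel) (ℓ : LetterReading) (ℓ₃ : T4Family → Node00.NE3Letters₁₁) (g B : T4Family → ℝ),
      GuardedReadingN16 𝔯 ksel ℓ ℓ₃ g B ∧ KeyedRatesHolderD4BFree β (rrOfRecord 𝔯 ksel))
    (h₂ : ∀ β : ℝ, 2 / 3 < β → β < 1 →
    ∀ (𝔯 : RateReading₁₃CoPH 2) (ksel : RunSel) (ℓ : LetterReading) (ℓ₃ : T4Family → Node00.NE3Letters₁₁) (g B : T4Family → ℝ),
      GuardedReadingN16 𝔯 ksel ℓ ℓ₃ g B → KeyedRatesHolderD4BFree β (rrOfRecord 𝔯 ksel) →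
      ∃ (jc : CutReading) (sh : ShellSplit₁₃CoPH 2 0) (cr : SpineReading), PinnedAtLive jc sh cr ∧
        KeyedRelWeight cr ∧ KeyedShellWeight cr ∧ KeyedExtractionBFree cr ∧ KeyedCoreEdgeHolderD4BFree β cr (rrOfRecord 𝔯 ksel)) :
    Summit.QuantumFields.YangMills.Theses.BalabanUVNodes.SpineGivenEndpointR13SepCoPH := by
  obtain ⟨β, hβ, hβ', 𝔯, ksel, ℓ, ℓ₃, g, B, hg, hr⟩ := h₁
  obtain ⟨_jc, _sh, cr, -, h20, h21, hx, h19⟩ := h₂ β hβ hβ' 𝔯 ksel ℓ ℓ₃ g B hg hr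
  exact fun F θ hP hG hθ _ _ =>
    Summit.QuantumFields.YangMills.BalabanUVNodes.N19CoreEdgeFSCComposer.keyedGuarded₁₃CoPH_of_keyedFacesP_fsc cr (rrOfRecord 𝔯 ksel)
      (fun θ => θ.ZhUnity _ 2 ∧ θ.SlotsNondegenerate₁₃ _ 2) (PHolderD4 β) h20 h21 (keyedRatesHolderD4_of_bFree hr) (keyedCoreEdgeHolderD4_of_bFree h19)
      (keyedExtraction_of_bFree hx) F θ hP.toCore hG hθ

end Summit.QuantumFields.YangMills.Theorems.K3V6Defs
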